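import Mathlib

/-!
# Crude two-sided bound for the complexified chord near the diagonal (`TangentSkeletonNearStraightL`, stmt-NavierStokesRegularity-23320,
# registered stub `stub_stripPropagation` — positivity margin on thin rectangles for the contour-independence step)

`F : ℂ → ℂ³` differentiable at the points of the segment `[ζ, z]` with `‖F′‖ ≤ M` there: `‖F(z) − F(ζ)‖ ≤ M‖z − ζ‖` (mean value on the convex
segment), hence `|Σᵢ (Fᵢ(z) − Fᵢ(ζ))²| ≤ 3M²‖z − ζ‖²` and in particular `Re Σᵢ (Fᵢ(z) − Fᵢ(ζ))² ≥ −3M²‖z − ζ‖²` (`re_chord_ge_neg`); with the matched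
core (`Re G ≥ A/2`, `κ ≥ 0`) the base has `Re ≥ κA/2 − 3M²‖z − ζ‖²` (`re_base_ge_core_sub`): the principal branch holds UNCONDITIONALLY for
`‖z − ζ‖ < √(κA/(6M²))`, which is what closes the gap `|Re(z−ζ)| < |Im(z−ζ)|` left by Theorems.StadiumContourPositivity.pair_chord_re_ge on the thin
rectangles between two plateau heights.  HONEST FRAMING: a tool for a HYPOTHETICAL filament skeleton on the NEGATIVE side of a MODEL route; nothing
here bears on Navier–Stokes regularity or blow-up.  `--supports stmt-NavierStokesRegularity-23320`.
-/

set_option linter.dupNamespace false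

noncomputable section

namespace Summit.NavierStokesRegularity.NavierStokesRegularity.Theorems.StadiumChordCrude

open Set Metric

/-- Mean value on the segment: `‖F z − F ζ‖ ≤ M‖z − ζ‖`. [folklore] -/
theorem norm_sub_le_of_segment {F : ℂ → (Fin 3 → ℂ)} {M : ℝ} {z ζ : ℂ}
    (hF : ∀ w ∈ segment ℝ ζ z, DifferentiableAt ℂ F w) (hM : ∀ w ∈ segment ℝ ζ z, ‖deriv F w‖ ≤ M) :
    ‖F z - F ζ‖ ≤ M * ‖z - ζ‖ :=
  Convex.norm_image_sub_le_of_norm_deriv_le hF hM (convex_segment ζ z) (left_mem_segment ℝ ζ z) (right_mem_segment ℝ ζ z)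

/-- `|Σᵢ vᵢ²| ≤ 3‖v‖²` (sup norm). [folklore] -/
theorem norm_sum_sq_le (v : Fin 3 → ℂ) : ‖∑ i, v i ^ 2‖ ≤ 3 * ‖v‖ ^ 2 := by
  calc ‖∑ i, v i ^ 2‖ ≤ ∑ i, ‖v i ^ 2‖ := norm_sum_le _ _
    _ ≤ ∑ _i : Fin 3, ‖v‖ ^ 2 := Finset.sum_le_sum fun i _ => by
        rw [norm_pow]; exact pow_le_pow_left₀ (norm_nonneg _) (norm_le_pi_norm v i) 2
    _ = 3 * ‖v‖ ^ 2 := by simp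

/-- **Crude lower bound near the diagonal**: `Re Σᵢ (Fᵢ(z) − Fᵢ(ζ))² ≥ −3M²‖z − ζ‖²`. [folklore] -/
theorem re_chord_ge_neg {F : ℂ → (Fin 3 → ℂ)} {M : ℝ} {z ζ : ℂ}
    (hF : ∀ w ∈ segment ℝ ζ z, DifferentiableAt ℂ F w) (hM : ∀ w ∈ segment ℝ ζ z, ‖deriv F w‖ ≤ M) :
    -(3 * M ^ 2 * ‖z - ζ‖ ^ 2) ≤ (∑ i, (F z i - F ζ i) ^ 2).re := by
  have h1 := norm_sub_le_of_segment hF hM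
  have hM0 : 0 ≤ M := (norm_nonneg _).trans (hM ζ (left_mem_segment ℝ ζ z))
  have h2 : ‖∑ i, (F z i - F ζ i) ^ 2‖ ≤ 3 * (M * ‖z - ζ‖) ^ 2 := by
    have h := norm_sum_sq_le (F z - F ζ)
    have e : (∑ i, (F z - F ζ) i ^ 2) = ∑ i, (F z i - F ζ i) ^ 2 := by simp [Pi.sub_apply]
    rw [e] at h
    refine h.trans ?_
    have := mul_le_mul_of_nonneg_left (pow_le_pow_left₀ (norm_nonneg _) h1 2) (by norm_num : (0:ℝ) ≤ 3)
    exact this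
  have h3 := (Complex.abs_re_le_norm (∑ i, (F z i - F ζ i) ^ 2)).trans h2
  have h4 := neg_abs_le (∑ i, (F z i - F ζ i) ^ 2).re
  nlinarith [h3, h4]

/-- **With the matched core**: `Re(Σᵢ (Fᵢ(z) − Fᵢ(ζ))² + κ·G) ≥ κA/2 − 3M²‖z − ζ‖²` when `Re G ≥ A/2`, `κ ≥ 0`. [folklore] -/
theorem re_base_ge_core_sub {F : ℂ → (Fin 3 → ℂ)} {M : ℝ} {z ζ : ℂ}
    (hF : ∀ w ∈ segment ℝ ζ z, DifferentiableAt ℂ F w) (hM : ∀ w ∈ segment ℝ ζ z, ‖deriv F w‖ ≤ M)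
    {κ Ar : ℝ} {Gv : ℂ} (hκ : 0 ≤ κ) (hG : Ar / 2 ≤ Gv.re) :
    κ * (Ar / 2) - 3 * M ^ 2 * ‖z - ζ‖ ^ 2 ≤ ((∑ i, (F z i - F ζ i) ^ 2) + (κ : ℂ) * Gv).re := by
  have h := re_chord_ge_neg hF hM
  rw [Complex.add_re, Complex.re_ofReal_mul]
  have h2 : κ * (Ar / 2) ≤ κ * Gv.re := mul_le_mul_of_nonneg_left hG hκ
  linarith

/-- **Unconditional principal branch close to the diagonal**: if `6M²‖z − ζ‖² < κA` then the base has positive real part. [folklore] -/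
theorem re_base_pos_of_near {F : ℂ → (Fin 3 → ℂ)} {M : ℝ} {z ζ : ℂ}
    (hF : ∀ w ∈ segment ℝ ζ z, DifferentiableAt ℂ F w) (hM : ∀ w ∈ segment ℝ ζ z, ‖deriv F w‖ ≤ M)
    {κ Ar : ℝ} {Gv : ℂ} (hκ : 0 ≤ κ) (hG : Ar / 2 ≤ Gv.re) (hnear : 6 * M ^ 2 * ‖z - ζ‖ ^ 2 < κ * Ar) :
    0 < ((∑ i, (F z i - F ζ i) ^ 2) + (κ : ℂ) * Gv).re := by
  have h := re_base_ge_core_sub hF hM hκ hG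
  linarith

end Summit.NavierStokesRegularity.NavierStokesRegularity.Theorems.StadiumChordCrude

end
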